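import Literature.Analysis.FluidPDE.ConvolutionCurlCalculus
import Literature.Analysis.FluidPDE.ConvolutionLaplacian
import Literature.Analysis.FluidPDE.VorticityCalculus
import Literature.Analysis.FluidPDE.NewtonKernel
import Literature.Analysis.FluidPDE.PressurePoisson
import Literature.Analysis.FluidPDE.VectorCalculusProofs
import Literature.Analysis.FluidPDE.EnstrophySplitting
import HarnessLib

/-!
# Kwon's harmonic part of a velocity slice: the annular-kernel realisation

Analysis/FluidPDE file on the discharge path of the named fact
`Literature.Analysis.FluidPDE.kwon2023_velocity_epsilon_regularity`
(`PressureFreeEpsilonRegularity.lean`; H. Kwon, *The role of the pressure in the regularity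
theory for the Navier–Stokes equations*, J. Differential Equations (2023) = arXiv:2104.03160,
Thm. 1.4). The printed proof (§2, Lemma 2.5) decomposes a solution on `Q₂` as `u = v + h` with
`v = ℙ_φ u = −curl Δ⁻¹(φ curl u)` (the localized Leray projection, Def. 2.1) and, by Remark 2.3,
for a divergence-free slice `g`,

  `g − ℙ_φ g = ∇Δ⁻¹(g·∇φ) − curl Δ⁻¹(∇φ × g)`  on `Ω₀ ⋐ {φ = 1}`,   (Remark 2.3)

"harmonic and smooth in `Ω₀`", with `‖∇ᵐ(ℙ_φ g − g)‖_{L^∞(Ω₀)} ≲ ‖g‖_{L¹(Ω)}` (2.4), whence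
(est.h) of Lemma 2.5: `‖∇ᵏh‖_{L^r(a,b;L^∞(B₁))} ≲_k ‖u‖_{L^r(a,b;L¹(B₂))}`.

**Design (what this file vendors).** On `Ω₀ = B₁` the right-hand side of (Remark 2.3) involves
the Newtonian kernel `Γ(x − y)` only for `x ∈ B₁` and `y` in the annulus `supp ∇φ`, i.e. for
`1/4 < |x − y| < 3` with the cut-off fixed here (`φ = θ_{5/4,7/4}`, `Kwon2023.kwonCutoff`): NO
singular integral is needed for the harmonic part. We therefore realise `Δ⁻¹` by the
**annular kernel** `k = θ_{3,4} · (1 − θ_{1/8,1/4}) Γ` (`Kwon2023.annularKernel`; smooth,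
compactly supported, `= Γ` on `1/4 ≤ |z| ≤ 3`, built from the tree's `radialCutoff`,
`newtonFar`) and DEFINE, for an arbitrary slice `u : ℝ³ → ℝ³`,

  `h = Kwon2023.harmonicPart u = ∇(k ⋆ (u·∇φ)) − curl (k ⋆ (∇φ × u))`

(Mathlib convolutions; the densities `Kwon2023.scalarDensity u = u·∇φ`,
`Kwon2023.vectorDensity u = ∇φ × u` live in `5/4 ≤ |y| ≤ 7/4`), which agrees with the printed
`h` on `B₁`. Proved here, for `u ∈ L¹(B₂)` (resp. locally integrable densities):

* `Kwon2023.contDiff_harmonicPart` — `h ∈ C^∞(ℝ³)`;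
* `Kwon2023.laplacian_potential_scalar_eq_zero`, `…_vector_eq_zero`,
  `Kwon2023.laplacian_harmonicPart_eq_zero` — the two potentials and `h` are harmonic on `B₁`
  (the kernel is harmonic on the shell; `Δ` passes onto the compactly supported kernel,
  `ConvolutionLaplacian.laplacian_convolution_left` and its vector-valued twin
  `Kwon2023.laplacian_convolution_lsmul_left`; `Δ` commutes with `∇`, `curl`);
* `Kwon2023.divergence_harmonicPart_eq_zero` — `div h = 0` on `B₁` (`div ∇ = Δ`, `div curl = 0`);
* `Kwon2023.exists_norm_harmonicPart_le`, `Kwon2023.exists_norm_fderiv_harmonicPart_le` —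
  (est.h)/(2.4) at orders zero and one, slice-wise and even globally in `x`:
  `‖h(x)‖ + ‖Dh(x)‖ ≤ C ∫_{B₂} |u|` with an absolute `C` (derivatives fall on the kernel:
  `Kwon2023.fderiv_potential_scalar_eq`, `…_vector_eq`).

Deliberately NOT here (next files on this path): the bounds for `∇ᵏh`, `k ≥ 2` (same proof, more
derivatives on the kernel); the identity `u = ℙ_φ u + h` on `B₁` for weakly divergence-free
`u` (Remark 2.3, by duality against `−curl(φ curl Γ⋆ξ)`); the time-dependent statements of
Lemma 2.5 and the equation for `v`.

## Mathlib / tree search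

Tree (reused): `radialCutoff*`, `newtonFar*`, `laplacian_newtonKernel` (`NewtonKernel`);
`fderiv_convolution_apply_eq` (`MollifiedField`); `ConvolutionLaplacian.laplacian_convolution_left`,
`…fderiv_convolution_left_apply`; `curl`, `cross`, `curlCLM`, `curl_eq_curlCLM(_comp)`,
`contDiff_curl` (`VorticityCalculus`), `divergence_curl_eq_zero_holds` (`VectorCalculusProofs`),
`divergence_gradient`, `divergence_sub_apply` (`PressurePoisson`),
`fderiv_laplacian_apply_of_contDiff_three` (`EnstrophySplitting`). Mathlib:
`HasCompactSupport.contDiff_convolution_left`, `laplacian_congr_nhds`, `laplacian_CLE_comp_left`,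
`ContDiffAt.laplacian_CLM_comp_left`, `ContDiffAt.laplacian_sub`,
`Continuous.comp_aestronglyMeasurable₂`. `lean search 'Kwon2023|harmonicPart|annularKernel'`: no
prior declarations.

## References

* H. Kwon, J. Differential Equations (2023) = arXiv:2104.03160: Def. 2.1, Remarks 2.2–2.3 with
  (2.4), Lemma 2.5 with (est.h) (arXiv pp. 6–8). [Kwon2023RolePressure]
* D. Gilbarg, N. S. Trudinger, *Elliptic partial differential equations of second order*
  (2001), (2.12)–(2.14) (the Newtonian kernel). [GilbargTrudinger2001]
-/

noncomputable section

open MeasureTheory Set Function Filter Topology TopologicalSpace Metric InnerProductSpace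
  ContinuousLinearMap
open scoped NNReal ENNReal RealInnerProductSpace Convolution Laplacian ContDiff

namespace Literature.Analysis.FluidPDE

namespace Kwon2023

/-! ### The annular Newtonian kernel -/

/-- The **annular Newtonian kernel** `k = θ₃,₄ · Γ∞`, `Γ∞ = (1 - θ_{1/8,1/4}) Γ`: a smooth,
compactly supported function on `ℝ³` which coincides with the Newtonian kernel
`Γ(z) = -1/(4π|z|)` on the shell `1/4 ≤ |z| ≤ 3`. [folklore] -/
def annularKernel (z : EuclideanSpace ℝ (Fin 3)) : ℝ :=
  radialCutoff 3 4 z * newtonFar (1 / 8) (1 / 4) z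

/-- The annular kernel is smooth. [folklore] -/
theorem contDiff_annularKernel {n : ℕ∞} : ContDiff ℝ n annularKernel :=
  (radialCutoff_contDiff (E' := EuclideanSpace ℝ (Fin 3)) 3 4).mul
    (contDiff_newtonFar (by norm_num) (by norm_num))

/-- The annular kernel vanishes off the open ball of radius `4`. [folklore] -/
theorem annularKernel_eq_zero {z : EuclideanSpace ℝ (Fin 3)} (hz : 4 ≤ ‖z‖) :
    annularKernel z = 0 := by
  rw [annularKernel, radialCutoff_eq_zero (by norm_num) (by norm_num) hz, zero_mul]

/-- The topological support of the annular kernel lies in `B̄(0, 4)`. [folklore] -/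
theorem tsupport_annularKernel_subset :
    tsupport annularKernel ⊆ closedBall (0 : EuclideanSpace ℝ (Fin 3)) 4 := by
  refine closure_minimal (fun z hz => ?_) isClosed_closedBall
  rw [mem_closedBall_zero_iff]
  by_contra h
  exact hz (annularKernel_eq_zero (not_le.1 h).le)

/-- The annular kernel has compact support. [folklore] -/
theorem hasCompactSupport_annularKernel : HasCompactSupport annularKernel :=
  (isCompact_closedBall (0 : EuclideanSpace ℝ (Fin 3)) 4).of_isClosed_subset isClosed_closure
    tsupport_annularKernel_subset

/-- **`k = Γ` on the shell `1/4 ≤ |z| ≤ 3`.** [folklore] -/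
theorem annularKernel_eq_newtonKernel {z : EuclideanSpace ℝ (Fin 3)} (h₁ : 1 / 4 ≤ ‖z‖)
    (h₂ : ‖z‖ ≤ 3) : annularKernel z = newtonKernel z := by
  rw [annularKernel, radialCutoff_eq_one (by norm_num) (by norm_num) h₂, one_mul,
    newtonFar_eq_newtonKernel (by norm_num) (by norm_num) h₁]

/-- On the open shell `1/4 < |z| < 3` the annular kernel agrees with `Γ` near `z`. [folklore] -/
theorem annularKernel_eventuallyEq_newtonKernel {z : EuclideanSpace ℝ (Fin 3)} (h₁ : 1 / 4 < ‖z‖)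
    (h₂ : ‖z‖ < 3) : annularKernel =ᶠ[𝓝 z] newtonKernel := by
  have ho : IsOpen {w : EuclideanSpace ℝ (Fin 3) | 1 / 4 < ‖w‖ ∧ ‖w‖ < 3} :=
    (isOpen_lt continuous_const continuous_norm).inter (isOpen_lt continuous_norm continuous_const)
  filter_upwards [ho.mem_nhds ⟨h₁, h₂⟩] with w hw
  exact annularKernel_eq_newtonKernel hw.1.le hw.2.le

/-- **The annular kernel is harmonic on the open shell** `1/4 < |z| < 3`. [folklore] -/
theorem laplacian_annularKernel {z : EuclideanSpace ℝ (Fin 3)} (h₁ : 1 / 4 < ‖z‖) (h₂ : ‖z‖ < 3) :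
    (Δ annularKernel) z = 0 := by
  have hz : z ≠ 0 := by
    rintro rfl
    rw [norm_zero] at h₁
    norm_num at h₁
  rw [(laplacian_congr_nhds (annularKernel_eventuallyEq_newtonKernel h₁ h₂)).eq_of_nhds]
  exact laplacian_newtonKernel hz

/-! ### Kwon's cut-off and the two densities -/

/-- Kwon's spatial cut-off `φ = θ_{5/4, 7/4}`: smooth, `φ = 1` on `|y| ≤ 5/4`, `φ = 0` on
`|y| ≥ 7/4` (Kwon 2023, Lemma 2.5: "`B₁ ⋐ {φ = 1}` and `supp(φ) ⊂ B₂`"). [cite: Kwon2023RolePressure, Lemma 2.5] -/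
def kwonCutoff : EuclideanSpace ℝ (Fin 3) → ℝ := radialCutoff (5 / 4) (7 / 4)

/-- The cut-off is smooth. [folklore] -/
theorem contDiff_kwonCutoff {n : ℕ∞} : ContDiff ℝ n kwonCutoff :=
  radialCutoff_contDiff (E' := EuclideanSpace ℝ (Fin 3)) _ _

/-- `∇φ = 0` inside `|y| < 5/4`. [folklore] -/
theorem gradient_kwonCutoff_eq_zero_of_lt {y : EuclideanSpace ℝ (Fin 3)} (hy : ‖y‖ < 5 / 4) :
    gradient kwonCutoff y = 0 := by
  have h : kwonCutoff =ᶠ[𝓝 y] fun _ => (1 : ℝ) :=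
    radialCutoff_eventuallyEq_one (E := EuclideanSpace ℝ (Fin 3)) (by norm_num) (by norm_num) hy
  rw [gradient, h.fderiv_eq, fderiv_const_apply, map_zero]

/-- `∇φ = 0` outside `|y| > 7/4`. [folklore] -/
theorem gradient_kwonCutoff_eq_zero_of_gt {y : EuclideanSpace ℝ (Fin 3)} (hy : 7 / 4 < ‖y‖) :
    gradient kwonCutoff y = 0 := by
  have h : kwonCutoff =ᶠ[𝓝 y] fun _ => (0 : ℝ) :=
    radialCutoff_eventuallyEq_zero (E := EuclideanSpace ℝ (Fin 3)) (by norm_num) (by norm_num) hy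
  rw [gradient, h.fderiv_eq, fderiv_const_apply, map_zero]

/-- The gradient of the cut-off is continuous. [folklore] -/
theorem continuous_gradient_kwonCutoff : Continuous (gradient kwonCutoff) :=
  FluidPDE.continuous_gradient_of_contDiff (contDiff_kwonCutoff (n := 1))

/-- A uniform bound `‖∇φ‖ ≤ C_φ` (continuous with compact support). [folklore] -/
theorem exists_bound_gradient_kwonCutoff : ∃ C : ℝ, 0 ≤ C ∧ ∀ y, ‖gradient kwonCutoff y‖ ≤ C := by
  have hc : HasCompactSupport (gradient kwonCutoff) := by
    refine HasCompactSupport.of_support_subset_isCompact (isCompact_closedBall 0 (7 / 4)) ?_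
    intro y hy
    rw [mem_closedBall_zero_iff]
    by_contra h
    exact hy (gradient_kwonCutoff_eq_zero_of_gt (not_le.1 h))
  obtain ⟨C, hC⟩ := continuous_gradient_kwonCutoff.bounded_above_of_compact_support hc
  exact ⟨max C 0, le_max_right _ _, fun y => (hC y).trans (le_max_left _ _)⟩

variable (u : EuclideanSpace ℝ (Fin 3) → EuclideanSpace ℝ (Fin 3))

/-- The scalar density `u·∇φ` (supported in the annulus `5/4 ≤ |y| ≤ 7/4`). [cite: Kwon2023RolePressure, Remark 2.3] -/
def scalarDensity (y : EuclideanSpace ℝ (Fin 3)) : ℝ := ⟪u y, gradient kwonCutoff y⟫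

/-- The vector density `∇φ × u` (supported in the annulus `5/4 ≤ |y| ≤ 7/4`). [cite: Kwon2023RolePressure, Remark 2.3] -/
def vectorDensity (y : EuclideanSpace ℝ (Fin 3)) : EuclideanSpace ℝ (Fin 3) :=
  cross (gradient kwonCutoff y) (u y)

variable {u}

/-- `u·∇φ = 0` inside `|y| < 5/4`. [folklore] -/
theorem scalarDensity_eq_zero_of_lt {y : EuclideanSpace ℝ (Fin 3)} (hy : ‖y‖ < 5 / 4) :
    scalarDensity u y = 0 := by
  rw [scalarDensity, gradient_kwonCutoff_eq_zero_of_lt hy, inner_zero_right]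

/-- `u·∇φ = 0` outside `|y| > 7/4`. [folklore] -/
theorem scalarDensity_eq_zero_of_gt {y : EuclideanSpace ℝ (Fin 3)} (hy : 7 / 4 < ‖y‖) :
    scalarDensity u y = 0 := by
  rw [scalarDensity, gradient_kwonCutoff_eq_zero_of_gt hy, inner_zero_right]

/-- `∇φ × u = 0` inside `|y| < 5/4`. [folklore] -/
theorem vectorDensity_eq_zero_of_lt {y : EuclideanSpace ℝ (Fin 3)} (hy : ‖y‖ < 5 / 4) :
    vectorDensity u y = 0 := by
  rw [vectorDensity, gradient_kwonCutoff_eq_zero_of_lt hy]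
  simp [cross]

/-- `∇φ × u = 0` outside `|y| > 7/4`. [folklore] -/
theorem vectorDensity_eq_zero_of_gt {y : EuclideanSpace ℝ (Fin 3)} (hy : 7 / 4 < ‖y‖) :
    vectorDensity u y = 0 := by
  rw [vectorDensity, gradient_kwonCutoff_eq_zero_of_gt hy]
  simp [cross]

/-! ### The harmonic part -/

variable (u) in
/-- **Kwon's harmonic part** of a velocity slice `u` (Kwon 2023, Remark 2.3 and Lemma 2.5:
`h = ∇Δ⁻¹(u·∇φ) − curl Δ⁻¹(∇φ × u)` on `B₁`), realised with the annular kernel `k` in place of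
`Γ`: `h = ∇(k ⋆ (u·∇φ)) − curl (k ⋆ (∇φ × u))`. Since `k = Γ` on `1/4 ≤ |z| ≤ 3` and the densities
live in `5/4 ≤ |y| ≤ 7/4`, this is Kwon's `h` on the ball `B₁`. [cite: Kwon2023RolePressure, Remark 2.3 and Lemma 2.5] -/
def harmonicPart (x : EuclideanSpace ℝ (Fin 3)) : EuclideanSpace ℝ (Fin 3) :=
  gradient (annularKernel ⋆ scalarDensity u) x -
    curl (annularKernel ⋆[lsmul ℝ ℝ, volume] vectorDensity u) x

/-- Smoothness of the scalar potential `k ⋆ (u·∇φ)` for a locally integrable density (Mathlib's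
`HasCompactSupport.contDiff_convolution_left`). [folklore] -/
theorem contDiff_potential_scalar (hu : LocallyIntegrable (scalarDensity u) volume) {n : ℕ∞} :
    ContDiff ℝ n (annularKernel ⋆ scalarDensity u) :=
  hasCompactSupport_annularKernel.contDiff_convolution_left _ contDiff_annularKernel hu

/-- Smoothness of the vector potential `k ⋆ (∇φ × u)`. [folklore] -/
theorem contDiff_potential_vector (hu : LocallyIntegrable (vectorDensity u) volume) {n : ℕ∞} :
    ContDiff ℝ n (annularKernel ⋆[lsmul ℝ ℝ, volume] vectorDensity u) :=
  hasCompactSupport_annularKernel.contDiff_convolution_left _ contDiff_annularKernel hu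

/-- **The harmonic part is smooth.** [cite: Kwon2023RolePressure, Remark 2.3] -/
theorem contDiff_harmonicPart (h₁ : LocallyIntegrable (scalarDensity u) volume)
    (h₂ : LocallyIntegrable (vectorDensity u) volume) {n : ℕ∞} :
    ContDiff ℝ n (harmonicPart u) := by
  have hg : ContDiff ℝ n (gradient (annularKernel ⋆ scalarDensity u)) :=
    (InnerProductSpace.toDual ℝ (EuclideanSpace ℝ (Fin 3))).symm.contDiff.comp
      ((contDiff_potential_scalar h₁ (n := n + 1)).fderiv_right (m := n) le_rfl)
  have hc : ContDiff ℝ n (curl (annularKernel ⋆[lsmul ℝ ℝ, volume] vectorDensity u)) :=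
    contDiff_curl (contDiff_potential_vector h₂ (n := n + 1))
  exact hg.sub hc


/-! ### Integrability of the densities -/

/-- `|u·∇φ| ≤ ‖∇φ‖_∞ |u|`. [folklore] -/
theorem norm_scalarDensity_le {C : ℝ} (hC : ∀ y, ‖gradient kwonCutoff y‖ ≤ C)
    (y : EuclideanSpace ℝ (Fin 3)) : ‖scalarDensity u y‖ ≤ C * ‖u y‖ := by
  rw [scalarDensity, Real.norm_eq_abs]
  calc |⟪u y, gradient kwonCutoff y⟫| ≤ ‖u y‖ * ‖gradient kwonCutoff y‖ := abs_real_inner_le_norm _ _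
    _ ≤ ‖u y‖ * C := mul_le_mul_of_nonneg_left (hC y) (norm_nonneg _)
    _ = C * ‖u y‖ := mul_comm _ _

/-- `|∇φ × u| ≤ ‖∇φ‖_∞ |u|`. [folklore] -/
theorem norm_vectorDensity_le {C : ℝ} (hC : ∀ y, ‖gradient kwonCutoff y‖ ≤ C)
    (y : EuclideanSpace ℝ (Fin 3)) : ‖vectorDensity u y‖ ≤ C * ‖u y‖ := by
  rw [vectorDensity, norm_cross]
  have h1 : Real.sin (InnerProductGeometry.angle (gradient kwonCutoff y) (u y)) ≤ 1 := Real.sin_le_one _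
  have h0 : 0 ≤ ‖gradient kwonCutoff y‖ * ‖u y‖ := by positivity
  calc ‖gradient kwonCutoff y‖ * ‖u y‖ * Real.sin (InnerProductGeometry.angle (gradient kwonCutoff y) (u y))
      ≤ ‖gradient kwonCutoff y‖ * ‖u y‖ * 1 := mul_le_mul_of_nonneg_left h1 h0
    _ ≤ C * ‖u y‖ * 1 := by gcongr; exact hC y
    _ = C * ‖u y‖ := mul_one _

/-- The scalar density vanishes off the ball `B₂`. [folklore] -/
theorem scalarDensity_eq_indicator :
    scalarDensity u = (ball (0 : EuclideanSpace ℝ (Fin 3)) 2).indicator (scalarDensity u) := by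
  funext y
  by_cases hy : y ∈ ball (0 : EuclideanSpace ℝ (Fin 3)) 2
  · rw [indicator_of_mem hy]
  · rw [indicator_of_notMem hy, scalarDensity_eq_zero_of_gt]
    rw [mem_ball_zero_iff, not_lt] at hy
    linarith

/-- The vector density vanishes off the ball `B₂`. [folklore] -/
theorem vectorDensity_eq_indicator :
    vectorDensity u = (ball (0 : EuclideanSpace ℝ (Fin 3)) 2).indicator (vectorDensity u) := by
  funext y
  by_cases hy : y ∈ ball (0 : EuclideanSpace ℝ (Fin 3)) 2
  · rw [indicator_of_mem hy]
  · rw [indicator_of_notMem hy, vectorDensity_eq_zero_of_gt]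
    rw [mem_ball_zero_iff, not_lt] at hy
    linarith

/-- **Integrability of the scalar density** for `u ∈ L¹(B₂)`. [folklore] -/
theorem integrable_scalarDensity (hu : IntegrableOn u (ball (0 : EuclideanSpace ℝ (Fin 3)) 2)) :
    Integrable (scalarDensity u) := by
  obtain ⟨C, -, hC⟩ := exists_bound_gradient_kwonCutoff
  rw [scalarDensity_eq_indicator, integrable_indicator_iff measurableSet_ball]
  refine Integrable.mono' (hu.norm.const_mul C) ?_ (Eventually.of_forall fun y => ?_)
  · exact hu.aestronglyMeasurable.inner continuous_gradient_kwonCutoff.aestronglyMeasurable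
  · exact norm_scalarDensity_le hC y

/-- **Integrability of the vector density** for `u ∈ L¹(B₂)`. [folklore] -/
theorem integrable_vectorDensity (hu : IntegrableOn u (ball (0 : EuclideanSpace ℝ (Fin 3)) 2)) :
    Integrable (vectorDensity u) := by
  obtain ⟨C, -, hC⟩ := exists_bound_gradient_kwonCutoff
  rw [vectorDensity_eq_indicator, integrable_indicator_iff measurableSet_ball]
  refine Integrable.mono' (hu.norm.const_mul C) ?_ (Eventually.of_forall fun y => ?_)
  · have hc : Continuous (uncurry cross) := by
      have : uncurry cross =
          fun p : EuclideanSpace ℝ (Fin 3) × EuclideanSpace ℝ (Fin 3) => crossCLM p.1 p.2 := by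
        funext p; rw [uncurry_def, crossCLM_apply]
      rw [this]
      exact crossCLM.continuous₂
    change AEStronglyMeasurable (fun y => cross (gradient kwonCutoff y) (u y)) _
    exact hc.comp_aestronglyMeasurable₂ continuous_gradient_kwonCutoff.aestronglyMeasurable
      hu.aestronglyMeasurable
  · exact norm_vectorDensity_le hC y

/-- `∫ |u·∇φ| ≤ ‖∇φ‖_∞ ∫_{B₂} |u|`. [folklore] -/
theorem integral_norm_scalarDensity_le {C : ℝ} (hC : ∀ y, ‖gradient kwonCutoff y‖ ≤ C)
    (hu : IntegrableOn u (ball (0 : EuclideanSpace ℝ (Fin 3)) 2)) :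
    ∫ y, ‖scalarDensity u y‖ ≤ C * ∫ y in ball (0 : EuclideanSpace ℝ (Fin 3)) 2, ‖u y‖ := by
  have e : (fun y => ‖scalarDensity u y‖) =
      (ball (0 : EuclideanSpace ℝ (Fin 3)) 2).indicator fun y => ‖scalarDensity u y‖ := by
    conv_lhs => rw [scalarDensity_eq_indicator (u := u)]
    funext y
    by_cases hy : y ∈ ball (0 : EuclideanSpace ℝ (Fin 3)) 2
    · rw [indicator_of_mem hy, indicator_of_mem hy]
    · rw [indicator_of_notMem hy, indicator_of_notMem hy, norm_zero]
  rw [e, integral_indicator measurableSet_ball, ← integral_const_mul]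
  refine integral_mono_of_nonneg (Eventually.of_forall fun y => norm_nonneg _)
    (hu.norm.const_mul C) (Eventually.of_forall fun y => norm_scalarDensity_le hC y)

/-- `∫ |∇φ × u| ≤ ‖∇φ‖_∞ ∫_{B₂} |u|`. [folklore] -/
theorem integral_norm_vectorDensity_le {C : ℝ} (hC : ∀ y, ‖gradient kwonCutoff y‖ ≤ C)
    (hu : IntegrableOn u (ball (0 : EuclideanSpace ℝ (Fin 3)) 2)) :
    ∫ y, ‖vectorDensity u y‖ ≤ C * ∫ y in ball (0 : EuclideanSpace ℝ (Fin 3)) 2, ‖u y‖ := by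
  have e : (fun y => ‖vectorDensity u y‖) =
      (ball (0 : EuclideanSpace ℝ (Fin 3)) 2).indicator fun y => ‖vectorDensity u y‖ := by
    conv_lhs => rw [vectorDensity_eq_indicator (u := u)]
    funext y
    by_cases hy : y ∈ ball (0 : EuclideanSpace ℝ (Fin 3)) 2
    · rw [indicator_of_mem hy, indicator_of_mem hy]
    · rw [indicator_of_notMem hy, indicator_of_notMem hy, norm_zero]
  rw [e, integral_indicator measurableSet_ball, ← integral_const_mul]
  refine integral_mono_of_nonneg (Eventually.of_forall fun y => norm_nonneg _)
    (hu.norm.const_mul C) (Eventually.of_forall fun y => norm_vectorDensity_le hC y)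

/-! ### The potentials are harmonic on `B₁` -/

/-- Geometry of the annulus: if `|x| < 1` and the density does not vanish at `x - t`
(`5/4 ≤ |x - t| ≤ 7/4`), then `t` lies in the open shell `1/4 < |t| < 3`. [folklore] -/
theorem shell_of_annulus {x t : EuclideanSpace ℝ (Fin 3)} (hx : ‖x‖ < 1) (h₁ : 5 / 4 ≤ ‖x - t‖)
    (h₂ : ‖x - t‖ ≤ 7 / 4) : 1 / 4 < ‖t‖ ∧ ‖t‖ < 3 := by
  constructor
  · have := norm_sub_le x t
    linarith
  · have h := norm_sub_le x (x - t)
    rw [sub_sub_cancel] at h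
    linarith

/-- **`Δ(f ⋆ g) = (Δf) ⋆ g`** for `f ∈ C²_c(ℝ³)` scalar and `g ∈ L¹_loc(ℝ³; F)` vector valued
(the vector-valued twin of the tree's `ConvolutionLaplacian.laplacian_convolution_left`).
[folklore] -/
theorem laplacian_convolution_lsmul_left {F : Type*} [NormedAddCommGroup F] [NormedSpace ℝ F]
    [CompleteSpace F] {f : EuclideanSpace ℝ (Fin 3) → ℝ} {g : EuclideanSpace ℝ (Fin 3) → F}
    (hfc : HasCompactSupport f) (hf : ContDiff ℝ 2 f) (hg : LocallyIntegrable g volume)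
    (x : EuclideanSpace ℝ (Fin 3)) :
    (Δ (f ⋆[lsmul ℝ ℝ, volume] g)) x = ((Δ f) ⋆[lsmul ℝ ℝ, volume] g) x := by
  set b := stdOrthonormalBasis ℝ (EuclideanSpace ℝ (Fin 3))
  -- `Δ v = Σᵢ ∂ᵢ∂ᵢ v` for `C²` fields with values in a normed space
  have key : ∀ {F' : Type _} [NormedAddCommGroup F'] [NormedSpace ℝ F']
      (v : EuclideanSpace ℝ (Fin 3) → F'), ContDiff ℝ 2 v → ∀ y,
      (Δ v) y = ∑ i, fderiv ℝ (fun y => fderiv ℝ v y (b i)) y (b i) := by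
    intro F' _ _ v hv y
    rw [InnerProductSpace.laplacian_eq_iteratedFDeriv_orthonormalBasis v b]
    refine Finset.sum_congr rfl fun i _ => ?_
    have hd : DifferentiableAt ℝ (fderiv ℝ v) y :=
      ((hv.fderiv_right (m := 1) le_rfl).differentiable one_ne_zero) y
    rw [iteratedFDeriv_two_apply, fderiv_clm_apply hd (differentiableAt_const _)]
    simp
  have hf1 : ContDiff ℝ 1 f := hf.of_le one_le_two
  have h2 : ContDiff ℝ 2 (f ⋆[lsmul ℝ ℝ, volume] g) := hfc.contDiff_convolution_left _ hf hg
  have hfe : ∀ e, ContDiff ℝ 1 fun z => fderiv ℝ f z e := fun e =>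
    (hf.fderiv_right (m := 1) le_rfl).clm_apply contDiff_const
  have hfec : ∀ e, HasCompactSupport fun z => fderiv ℝ f z e := fun e =>
    hfc.fderiv_apply (𝕜 := ℝ) e
  -- first derivatives: `∂ₑ(f ⋆ g) = (∂ₑ f) ⋆ g`
  have hD1 : ∀ e, (fun y => fderiv ℝ (f ⋆[lsmul ℝ ℝ, volume] g) y e) =
      ((fun z => fderiv ℝ f z e) ⋆[lsmul ℝ ℝ, volume] g) := fun e => by
    funext y
    rw [fderiv_convolution_apply_eq hf1 hfc hg y e, convolution_lsmul_swap]
  -- second derivatives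
  have hD2 : ∀ e, fderiv ℝ (fun y => fderiv ℝ (f ⋆[lsmul ℝ ℝ, volume] g) y e) x e =
      ((fun z => fderiv ℝ (fun w => fderiv ℝ f w e) z e) ⋆[lsmul ℝ ℝ, volume] g) x := fun e => by
    rw [hD1 e, fderiv_convolution_apply_eq (hfe e) (hfec e) hg x e, convolution_lsmul_swap]
  rw [key _ h2 x]
  simp_rw [hD2]
  have hint : ∀ i, Integrable (fun t => (fderiv ℝ (fun w => fderiv ℝ f w (b i)) t (b i)) • g (x - t))
      volume := fun i =>
    ((hfec (b i)).fderiv_apply (𝕜 := ℝ) (b i)).convolutionExists_left (lsmul ℝ ℝ)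
      ((hfe (b i)).continuous_fderiv one_ne_zero |>.clm_apply continuous_const) hg x
  simp only [convolution_lsmul]
  rw [← integral_finsetSum _ fun i _ => hint i]
  refine integral_congr_ae (Eventually.of_forall fun t => ?_)
  simp only
  rw [FluidPDE.laplacian_eq_sum_fderiv_fderiv b hf t, Finset.sum_smul]

/-- **The scalar potential `k ⋆ (u·∇φ)` is harmonic on `B₁`** (the kernel is harmonic on the
shell `1/4 < |t| < 3`, which contains `x - y` for `|x| < 1` and `y` in the annulus). [cite: Kwon2023RolePressure, Remark 2.3] -/
theorem laplacian_potential_scalar_eq_zero (hu : LocallyIntegrable (scalarDensity u) volume)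
    {x : EuclideanSpace ℝ (Fin 3)} (hx : ‖x‖ < 1) :
    (Δ (annularKernel ⋆ scalarDensity u)) x = 0 := by
  rw [ConvolutionLaplacian.laplacian_convolution_left hasCompactSupport_annularKernel
    contDiff_annularKernel hu x, convolution_lsmul]
  refine integral_eq_zero_of_ae (Eventually.of_forall fun t => ?_)
  simp only [Pi.zero_apply, smul_eq_mul]
  by_cases h : 5 / 4 ≤ ‖x - t‖ ∧ ‖x - t‖ ≤ 7 / 4
  · obtain ⟨ht₁, ht₂⟩ := shell_of_annulus hx h.1 h.2
    rw [laplacian_annularKernel ht₁ ht₂, zero_mul]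
  · rcases lt_or_ge ‖x - t‖ (5 / 4) with h1 | h1
    · rw [scalarDensity_eq_zero_of_lt h1, mul_zero]
    · rw [scalarDensity_eq_zero_of_gt (not_le.1 fun h2 => h ⟨h1, h2⟩), mul_zero]

/-- **The vector potential `k ⋆ (∇φ × u)` is harmonic on `B₁`.** [cite: Kwon2023RolePressure, Remark 2.3] -/
theorem laplacian_potential_vector_eq_zero (hu : LocallyIntegrable (vectorDensity u) volume)
    {x : EuclideanSpace ℝ (Fin 3)} (hx : ‖x‖ < 1) :
    (Δ (annularKernel ⋆[lsmul ℝ ℝ, volume] vectorDensity u)) x = 0 := by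
  rw [laplacian_convolution_lsmul_left hasCompactSupport_annularKernel contDiff_annularKernel hu x,
    convolution_lsmul]
  refine integral_eq_zero_of_ae (Eventually.of_forall fun t => ?_)
  simp only [Pi.zero_apply]
  by_cases h : 5 / 4 ≤ ‖x - t‖ ∧ ‖x - t‖ ≤ 7 / 4
  · obtain ⟨ht₁, ht₂⟩ := shell_of_annulus hx h.1 h.2
    rw [laplacian_annularKernel ht₁ ht₂, zero_smul]
  · rcases lt_or_ge ‖x - t‖ (5 / 4) with h1 | h1
    · rw [vectorDensity_eq_zero_of_lt h1, smul_zero]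
    · rw [vectorDensity_eq_zero_of_gt (not_le.1 fun h2 => h ⟨h1, h2⟩), smul_zero]

/-! ### The harmonic part is divergence free on `B₁` -/

/-- **`div h = 0` on `B₁`**: `div ∇(k ⋆ (u·∇φ)) = Δ(k ⋆ (u·∇φ)) = 0` there and `div curl = 0`
(Kwon 2023, Lemma 2.5: "`h` is divergence-free … in `(-4,0) × B₁`"). [cite: Kwon2023RolePressure, Lemma 2.5] -/
theorem divergence_harmonicPart_eq_zero (h₁ : LocallyIntegrable (scalarDensity u) volume)
    (h₂ : LocallyIntegrable (vectorDensity u) volume) {x : EuclideanSpace ℝ (Fin 3)}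
    (hx : ‖x‖ < 1) : VectorCalculus.divergence (harmonicPart u) x = 0 := by
  have hF : ContDiff ℝ 2 (annularKernel ⋆ scalarDensity u) := contDiff_potential_scalar h₁
  have hG : ContDiff ℝ 2 (annularKernel ⋆[lsmul ℝ ℝ, volume] vectorDensity u) :=
    contDiff_potential_vector h₂
  have hgrad : ContDiff ℝ 1 (gradient (annularKernel ⋆ scalarDensity u)) :=
    (InnerProductSpace.toDual ℝ (EuclideanSpace ℝ (Fin 3))).symm.contDiff.comp
      (hF.fderiv_right (m := 1) le_rfl)
  have hcurl : ContDiff ℝ 1 (curl (annularKernel ⋆[lsmul ℝ ℝ, volume] vectorDensity u)) :=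
    contDiff_curl (contDiff_potential_vector h₂ (n := 2))
  rw [show harmonicPart u = fun y => gradient (annularKernel ⋆ scalarDensity u) y -
      curl (annularKernel ⋆[lsmul ℝ ℝ, volume] vectorDensity u) y from rfl,
    divergence_sub_apply (hgrad.differentiable one_ne_zero x)
      (hcurl.differentiable one_ne_zero x),
    divergence_gradient hF x, laplacian_potential_scalar_eq_zero h₁ hx,
    divergence_curl_eq_zero_holds _ hG x, sub_zero]


/-! ### Sup bounds: `‖h‖_{L^∞} ≲ ‖u‖_{L¹(B₂)}` -/

/-- **Sup bound for a kernel integral against an `L¹` density**: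
`‖∫ k(x - t) g(t) dt‖ ≤ ‖k‖_∞ ‖g‖_{L¹}`. [folklore] -/
theorem norm_integral_comp_sub_smul_le {F : Type*} [NormedAddCommGroup F] [NormedSpace ℝ F]
    {k : EuclideanSpace ℝ (Fin 3) → ℝ} {g : EuclideanSpace ℝ (Fin 3) → F} {K : ℝ}
    (hK : ∀ z, ‖k z‖ ≤ K) (hg : Integrable g) (x : EuclideanSpace ℝ (Fin 3)) :
    ‖∫ t, k (x - t) • g t‖ ≤ K * ∫ y, ‖g y‖ := by
  calc ‖∫ t, k (x - t) • g t‖ ≤ ∫ t, ‖k (x - t) • g t‖ := norm_integral_le_integral_norm _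
    _ ≤ ∫ t, K * ‖g t‖ := by
        refine integral_mono_of_nonneg (Eventually.of_forall fun t => norm_nonneg _)
          (hg.norm.const_mul K) (Eventually.of_forall fun t => ?_)
        show ‖k (x - t) • g t‖ ≤ K * ‖g t‖
        rw [norm_smul]
        exact mul_le_mul_of_nonneg_right (hK _) (norm_nonneg _)
    _ = K * ∫ t, ‖g t‖ := integral_const_mul _ _

/-- `‖(k ⋆ g)(x)‖ ≤ ‖k‖_∞ ‖g‖_{L¹}` in convolution notation. [folklore] -/
theorem norm_convolution_lsmul_le {F : Type*} [NormedAddCommGroup F] [NormedSpace ℝ F]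
    {k : EuclideanSpace ℝ (Fin 3) → ℝ} {g : EuclideanSpace ℝ (Fin 3) → F} {K : ℝ}
    (hK : ∀ z, ‖k z‖ ≤ K) (hg : Integrable g) (x : EuclideanSpace ℝ (Fin 3)) :
    ‖(k ⋆[lsmul ℝ ℝ, volume] g) x‖ ≤ K * ∫ y, ‖g y‖ := by
  rw [convolution_lsmul_swap]
  exact norm_integral_comp_sub_smul_le hK hg x

/-- A uniform bound for the derivative of the annular kernel. [folklore] -/
theorem exists_bound_fderiv_annularKernel :
    ∃ K : ℝ, 0 ≤ K ∧ ∀ z a, ‖fderiv ℝ annularKernel z a‖ ≤ K * ‖a‖ := by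
  have hc : Continuous (fderiv ℝ annularKernel) :=
    contDiff_annularKernel.continuous_fderiv (n := 1) one_ne_zero
  obtain ⟨K, hK⟩ := hc.bounded_above_of_compact_support
    (hasCompactSupport_annularKernel.fderiv (𝕜 := ℝ))
  refine ⟨max K 0, le_max_right _ _, fun z a => ?_⟩
  calc ‖fderiv ℝ annularKernel z a‖ ≤ ‖fderiv ℝ annularKernel z‖ * ‖a‖ := le_opNorm _ _
    _ ≤ max K 0 * ‖a‖ := mul_le_mul_of_nonneg_right ((hK z).trans (le_max_left _ _)) (norm_nonneg _)

/-- **`‖∇(k ⋆ d)(x)‖ ≤ ‖∇k‖_∞ ‖d‖_{L¹}`** for the scalar potential. [folklore] -/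
theorem norm_gradient_potential_scalar_le {K : ℝ} (hK0 : 0 ≤ K)
    (hK : ∀ z a, ‖fderiv ℝ annularKernel z a‖ ≤ K * ‖a‖) (hd : Integrable (scalarDensity u))
    (x : EuclideanSpace ℝ (Fin 3)) :
    ‖gradient (annularKernel ⋆ scalarDensity u) x‖ ≤ K * ∫ y, ‖scalarDensity u y‖ := by
  have hI : 0 ≤ ∫ y, ‖scalarDensity u y‖ := integral_nonneg fun _ => norm_nonneg _
  rw [gradient, LinearIsometryEquiv.norm_map]
  refine ContinuousLinearMap.opNorm_le_bound _ (by positivity) fun a => ?_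
  rw [ConvolutionLaplacian.fderiv_convolution_left_apply hasCompactSupport_annularKernel
    (contDiff_annularKernel (n := 1)) hd.locallyIntegrable x a]
  calc ‖((fun z => fderiv ℝ annularKernel z a) ⋆ scalarDensity u) x‖
      ≤ K * ‖a‖ * ∫ y, ‖scalarDensity u y‖ :=
        norm_convolution_lsmul_le (fun z => hK z a) hd x
    _ = K * (∫ y, ‖scalarDensity u y‖) * ‖a‖ := by ring

/-- **`‖curl (k ⋆ d)(x)‖ ≤ ‖curl‖ ‖∇k‖_∞ ‖d‖_{L¹}`** for the vector potential. [folklore] -/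
theorem norm_curl_potential_vector_le {K : ℝ} (hK0 : 0 ≤ K)
    (hK : ∀ z a, ‖fderiv ℝ annularKernel z a‖ ≤ K * ‖a‖) (hd : Integrable (vectorDensity u))
    (x : EuclideanSpace ℝ (Fin 3)) :
    ‖curl (annularKernel ⋆[lsmul ℝ ℝ, volume] vectorDensity u) x‖ ≤
      ‖curlCLM‖ * K * ∫ y, ‖vectorDensity u y‖ := by
  have hI : 0 ≤ ∫ y, ‖vectorDensity u y‖ := integral_nonneg fun _ => norm_nonneg _
  have hD : ‖fderiv ℝ (annularKernel ⋆[lsmul ℝ ℝ, volume] vectorDensity u) x‖ ≤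
      K * ∫ y, ‖vectorDensity u y‖ := by
    refine ContinuousLinearMap.opNorm_le_bound _ (by positivity) fun a => ?_
    rw [fderiv_convolution_apply_eq (contDiff_annularKernel (n := 1))
      hasCompactSupport_annularKernel hd.locallyIntegrable x a]
    calc ‖∫ y, (fderiv ℝ annularKernel (x - y) a) • vectorDensity u y‖
        ≤ K * ‖a‖ * ∫ y, ‖vectorDensity u y‖ :=
          norm_integral_comp_sub_smul_le (k := fun z => fderiv ℝ annularKernel z a)
            (fun z => hK z a) hd x
      _ = K * (∫ y, ‖vectorDensity u y‖) * ‖a‖ := by ring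
  rw [curl_eq_curlCLM]
  calc ‖curlCLM (fderiv ℝ (annularKernel ⋆[lsmul ℝ ℝ, volume] vectorDensity u) x)‖
      ≤ ‖curlCLM‖ * ‖fderiv ℝ (annularKernel ⋆[lsmul ℝ ℝ, volume] vectorDensity u) x‖ :=
        le_opNorm _ _
    _ ≤ ‖curlCLM‖ * (K * ∫ y, ‖vectorDensity u y‖) :=
        mul_le_mul_of_nonneg_left hD (norm_nonneg curlCLM)
    _ = ‖curlCLM‖ * K * ∫ y, ‖vectorDensity u y‖ := by ring

/-- **The harmonic part is bounded by the `L¹(B₂)` norm of the velocity** (Kwon 2023,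
Remark 2.3, (2.4) with `m = 0`, and Lemma 2.5, (est.h) with `k = 0` at a fixed time:
`‖h‖_{L^∞(B₁)} ≲ ‖u‖_{L¹(B₂)}`; here even globally in `x`): there is an absolute `C` with
`‖h(x)‖ ≤ C ∫_{B₂} |u|` for every `u ∈ L¹(B₂)` and every `x`. [cite: Kwon2023RolePressure, Remark 2.3 (2.4) and Lemma 2.5 (est.h)] -/
theorem exists_norm_harmonicPart_le :
    ∃ C : ℝ, 0 ≤ C ∧ ∀ (u : EuclideanSpace ℝ (Fin 3) → EuclideanSpace ℝ (Fin 3)),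
      IntegrableOn u (ball (0 : EuclideanSpace ℝ (Fin 3)) 2) →
      ∀ x, ‖harmonicPart u x‖ ≤ C * ∫ y in ball (0 : EuclideanSpace ℝ (Fin 3)) 2, ‖u y‖ := by
  obtain ⟨K, hK0, hK⟩ := exists_bound_fderiv_annularKernel
  obtain ⟨Cφ, hCφ0, hCφ⟩ := exists_bound_gradient_kwonCutoff
  refine ⟨(K + ‖curlCLM‖ * K) * Cφ, by positivity, fun u hu x => ?_⟩
  have hd₁ := integrable_scalarDensity hu
  have hd₂ := integrable_vectorDensity hu
  have hI : 0 ≤ ∫ y in ball (0 : EuclideanSpace ℝ (Fin 3)) 2, ‖u y‖ :=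
    integral_nonneg fun _ => norm_nonneg _
  have h1 := norm_gradient_potential_scalar_le hK0 hK hd₁ x
  have h2 := norm_curl_potential_vector_le hK0 hK hd₂ x
  have h3 := integral_norm_scalarDensity_le hCφ hu
  have h4 := integral_norm_vectorDensity_le hCφ hu
  calc ‖harmonicPart u x‖
      ≤ ‖gradient (annularKernel ⋆ scalarDensity u) x‖ +
          ‖curl (annularKernel ⋆[lsmul ℝ ℝ, volume] vectorDensity u) x‖ := norm_sub_le _ _
    _ ≤ K * (Cφ * ∫ y in ball (0 : EuclideanSpace ℝ (Fin 3)) 2, ‖u y‖) +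
          ‖curlCLM‖ * K * (Cφ * ∫ y in ball (0 : EuclideanSpace ℝ (Fin 3)) 2, ‖u y‖) := by
        gcongr
        · exact h1.trans (mul_le_mul_of_nonneg_left h3 hK0)
        · exact h2.trans (mul_le_mul_of_nonneg_left h4 (by positivity))
    _ = (K + ‖curlCLM‖ * K) * Cφ * ∫ y in ball (0 : EuclideanSpace ℝ (Fin 3)) 2, ‖u y‖ := by
        ring


/-! ### The harmonic part is harmonic on `B₁` -/

/-- **`Δ(Dv) = D(Δv)`** as continuous linear maps, for a `C³` field (Schwarz; the tree's
`fderiv_laplacian_apply_of_contDiff_three` evaluated). [folklore] -/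
theorem laplacian_fderiv_eq_fderiv_laplacian_of_contDiff_three {F : Type*} [NormedAddCommGroup F]
    [InnerProductSpace ℝ F] {v : EuclideanSpace ℝ (Fin 3) → F} (hv : ContDiff ℝ 3 v)
    (x : EuclideanSpace ℝ (Fin 3)) : (Δ (fderiv ℝ v)) x = fderiv ℝ (Δ v) x := by
  ext a
  have h2 : ContDiffAt ℝ 2 (fderiv ℝ v) x :=
    ((hv.fderiv_right (m := 2) (by norm_cast)).of_le le_rfl).contDiffAt
  have h := h2.laplacian_CLM_comp_left (l := ContinuousLinearMap.apply ℝ F a)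
  have h' : (Δ (fun z => fderiv ℝ v z a)) x = (Δ (fderiv ℝ v)) x a := by
    simpa [Function.comp_def] using h
  rw [← h', fderiv_laplacian_apply_of_contDiff_three hv x a]

/-- **`Δh = 0` on `B₁`**: both potentials are harmonic on the open ball `B₁`, and `Δ` commutes
with `∇` and `curl` (Kwon 2023, Remark 2.3: "the error `g − ℙ_φ g` … is harmonic and smooth in
`Ω₀`"; Lemma 2.5: "`h` is … harmonic in `(-4,0) × B₁`"). [cite: Kwon2023RolePressure, Remark 2.3 and Lemma 2.5] -/
theorem laplacian_harmonicPart_eq_zero (h₁ : LocallyIntegrable (scalarDensity u) volume)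
    (h₂ : LocallyIntegrable (vectorDensity u) volume) {x : EuclideanSpace ℝ (Fin 3)}
    (hx : ‖x‖ < 1) : (Δ (harmonicPart u)) x = 0 := by
  set F := annularKernel ⋆ scalarDensity u with hFdef
  set G := annularKernel ⋆[lsmul ℝ ℝ, volume] vectorDensity u with hGdef
  have hF : ContDiff ℝ 3 F := contDiff_potential_scalar h₁
  have hG : ContDiff ℝ 3 G := contDiff_potential_vector h₂
  have hball : ball (0 : EuclideanSpace ℝ (Fin 3)) 1 ∈ 𝓝 x :=
    isOpen_ball.mem_nhds (mem_ball_zero_iff.2 hx)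
  have hΔF : Δ F =ᶠ[𝓝 x] fun _ => (0 : ℝ) := by
    filter_upwards [hball] with y hy
    exact laplacian_potential_scalar_eq_zero h₁ (mem_ball_zero_iff.1 hy)
  have hΔG : Δ G =ᶠ[𝓝 x] fun _ => (0 : EuclideanSpace ℝ (Fin 3)) := by
    filter_upwards [hball] with y hy
    exact laplacian_potential_vector_eq_zero h₂ (mem_ball_zero_iff.1 hy)
  -- the gradient piece
  have hA : (Δ (gradient F)) x = 0 := by
    have e : gradient F =
        ((InnerProductSpace.toDual ℝ (EuclideanSpace ℝ (Fin 3))).symm.toContinuousLinearEquiv :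
          StrongDual ℝ (EuclideanSpace ℝ (Fin 3)) ≃L[ℝ] EuclideanSpace ℝ (Fin 3)) ∘ fderiv ℝ F := by
      funext y; rfl
    rw [e, laplacian_CLE_comp_left, Function.comp_apply,
      laplacian_fderiv_eq_fderiv_laplacian_of_contDiff_three hF x, hΔF.fderiv_eq,
      fderiv_const_apply, map_zero]
  -- the curl piece
  have hB : (Δ (curl G)) x = 0 := by
    have h2 : ContDiffAt ℝ 2 (fderiv ℝ G) x :=
      ((hG.fderiv_right (m := 2) (by norm_cast)).of_le le_rfl).contDiffAt
    rw [curl_eq_curlCLM_comp, h2.laplacian_CLM_comp_left, Function.comp_apply,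
      laplacian_fderiv_eq_fderiv_laplacian_of_contDiff_three hG x, hΔG.fderiv_eq,
      fderiv_const_apply, map_zero]
  -- assemble
  have hgrad : ContDiffAt ℝ 2 (gradient F) x :=
    ((InnerProductSpace.toDual ℝ (EuclideanSpace ℝ (Fin 3))).symm.contDiff.comp
      (hF.fderiv_right (m := 2) (by norm_cast))).contDiffAt
  have hcurl : ContDiffAt ℝ 2 (curl G) x :=
    (contDiff_curl (n := 2) (contDiff_potential_vector h₂)).contDiffAt
  rw [show harmonicPart u = gradient F - curl G from rfl, hgrad.laplacian_sub hcurl, hA, hB,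
    sub_zero]


/-! ### Sup bounds for `∇h`: (est.h) at order one -/

/-- A uniform bound for the second derivative of the annular kernel (through the partial
derivatives `∂ⱼk`, expanding the direction `b` in the standard basis). [folklore] -/
theorem exists_bound_fderiv_fderiv_annularKernel :
    ∃ K : ℝ, 0 ≤ K ∧ ∀ z a b,
      ‖fderiv ℝ (fun w => fderiv ℝ annularKernel w b) z a‖ ≤ K * ‖a‖ * ‖b‖ := by
  set e := EuclideanSpace.basisFun (Fin 3) ℝ with he
  have hk1 : ContDiff ℝ 1 (fderiv ℝ annularKernel) :=
    (contDiff_annularKernel (n := 2)).fderiv_right (m := 1) le_rfl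
  have hkj : ∀ j, ContDiff ℝ 1 fun w => fderiv ℝ annularKernel w (e j) := fun j =>
    hk1.clm_apply contDiff_const
  have hkjc : ∀ j, HasCompactSupport fun w => fderiv ℝ annularKernel w (e j) := fun j =>
    hasCompactSupport_annularKernel.fderiv_apply (𝕜 := ℝ) (e j)
  have hb : ∀ j, ∃ K, 0 ≤ K ∧ ∀ z,
      ‖fderiv ℝ (fun w => fderiv ℝ annularKernel w (e j)) z‖ ≤ K := fun j => by
    obtain ⟨K, hK⟩ := ((hkj j).continuous_fderiv one_ne_zero).bounded_above_of_compact_support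
      ((hkjc j).fderiv (𝕜 := ℝ))
    exact ⟨max K 0, le_max_right _ _, fun z => (hK z).trans (le_max_left _ _)⟩
  choose K hK0 hK using hb
  refine ⟨∑ j, K j, Finset.sum_nonneg fun j _ => hK0 j, fun z a b => ?_⟩
  -- expand `b` in the standard basis
  have hexp : (fun w => fderiv ℝ annularKernel w b) =
      fun w => ∑ j, b j • fderiv ℝ annularKernel w (e j) := by
    funext w
    conv_lhs => rw [← (EuclideanSpace.basisFun (Fin 3) ℝ).sum_repr b]
    simp only [map_sum, map_smul, EuclideanSpace.basisFun_repr, smul_eq_mul, he]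
  have hdj : ∀ j, DifferentiableAt ℝ (fun w => fderiv ℝ annularKernel w (e j)) z := fun j =>
    (hkj j).differentiable one_ne_zero z
  have hD : HasFDerivAt (fun w => ∑ j, b j • fderiv ℝ annularKernel w (e j))
      (∑ j, b j • fderiv ℝ (fun w => fderiv ℝ annularKernel w (e j)) z) z :=
    HasFDerivAt.fun_sum fun j _ => (hdj j).hasFDerivAt.const_smul (b j)
  rw [hexp, hD.fderiv]
  simp only [FunLike.coe_sum, Finset.sum_apply, _root_.smul_apply]
  calc ‖∑ j, b j • fderiv ℝ (fun w => fderiv ℝ annularKernel w (e j)) z a‖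
      ≤ ∑ j, ‖b j • fderiv ℝ (fun w => fderiv ℝ annularKernel w (e j)) z a‖ := norm_sum_le _ _
    _ ≤ ∑ j, K j * ‖a‖ * ‖b‖ := Finset.sum_le_sum fun j _ => ?_
    _ = (∑ j, K j) * ‖a‖ * ‖b‖ := by rw [Finset.sum_mul, Finset.sum_mul]
  rw [norm_smul, Real.norm_eq_abs]
  have h1 : |b j| ≤ ‖b‖ := by
    have := PiLp.norm_apply_le b j
    rwa [Real.norm_eq_abs] at this
  have h2 : ‖fderiv ℝ (fun w => fderiv ℝ annularKernel w (e j)) z a‖ ≤ K j * ‖a‖ :=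
    (le_opNorm _ _).trans (mul_le_mul_of_nonneg_right (hK j z) (norm_nonneg _))
  calc |b j| * ‖fderiv ℝ (fun w => fderiv ℝ annularKernel w (e j)) z a‖
      ≤ ‖b‖ * (K j * ‖a‖) := mul_le_mul h1 h2 (norm_nonneg _) (norm_nonneg _)
    _ = K j * ‖a‖ * ‖b‖ := by ring

/-- **Directional derivatives of the scalar potential are again potentials**:
`∂_b (k ⋆ d) = (∂_b k) ⋆ d` as functions. [folklore] -/
theorem fderiv_potential_scalar_eq (hd : LocallyIntegrable (scalarDensity u) volume)
    (b : EuclideanSpace ℝ (Fin 3)) :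
    (fun y => fderiv ℝ (annularKernel ⋆ scalarDensity u) y b) =
      ((fun z => fderiv ℝ annularKernel z b) ⋆ scalarDensity u) :=
  funext fun y => ConvolutionLaplacian.fderiv_convolution_left_apply
    hasCompactSupport_annularKernel (contDiff_annularKernel (n := 1)) hd y b

/-- **Directional derivatives of the vector potential are again potentials**:
`∂_b (k ⋆ d) = (∂_b k) ⋆ d` as functions. [folklore] -/
theorem fderiv_potential_vector_eq (hd : LocallyIntegrable (vectorDensity u) volume)
    (b : EuclideanSpace ℝ (Fin 3)) :
    (fun y => fderiv ℝ (annularKernel ⋆[lsmul ℝ ℝ, volume] vectorDensity u) y b) =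
      ((fun z => fderiv ℝ annularKernel z b) ⋆[lsmul ℝ ℝ, volume] vectorDensity u) := by
  funext y
  rw [convolution_lsmul_swap]
  exact fderiv_convolution_apply_eq (contDiff_annularKernel (n := 1))
    hasCompactSupport_annularKernel hd y b

/-- **`‖D²(k ⋆ d)(x)‖ ≤ ‖D²k‖_∞ ‖d‖_{L¹}`** for the scalar potential. [folklore] -/
theorem norm_fderiv_fderiv_potential_scalar_le {K : ℝ} (hK0 : 0 ≤ K)
    (hK : ∀ z a b, ‖fderiv ℝ (fun w => fderiv ℝ annularKernel w b) z a‖ ≤ K * ‖a‖ * ‖b‖)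
    (hd : Integrable (scalarDensity u)) (x : EuclideanSpace ℝ (Fin 3)) :
    ‖fderiv ℝ (fderiv ℝ (annularKernel ⋆ scalarDensity u)) x‖ ≤ K * ∫ y, ‖scalarDensity u y‖ := by
  have hI : 0 ≤ ∫ y, ‖scalarDensity u y‖ := integral_nonneg fun _ => norm_nonneg _
  have hF : ContDiff ℝ 2 (annularKernel ⋆ scalarDensity u) :=
    contDiff_potential_scalar hd.locallyIntegrable
  have hdF : DifferentiableAt ℝ (fderiv ℝ (annularKernel ⋆ scalarDensity u)) x :=
    ((hF.fderiv_right (m := 1) le_rfl).differentiable one_ne_zero) x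
  refine ContinuousLinearMap.opNorm_le_bound _ (by positivity) fun a => ?_
  refine ContinuousLinearMap.opNorm_le_bound _ (by positivity) fun b => ?_
  have hkb : ContDiff ℝ 1 fun z => fderiv ℝ annularKernel z b :=
    (contDiff_annularKernel.fderiv_right (m := 1) le_rfl).clm_apply contDiff_const
  have hkbc : HasCompactSupport fun z => fderiv ℝ annularKernel z b :=
    hasCompactSupport_annularKernel.fderiv_apply (𝕜 := ℝ) b
  rw [← fderiv_apply_const_apply hdF b a, fderiv_potential_scalar_eq hd.locallyIntegrable b,
    ConvolutionLaplacian.fderiv_convolution_left_apply hkbc hkb hd.locallyIntegrable x a]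
  calc ‖((fun z => fderiv ℝ (fun w => fderiv ℝ annularKernel w b) z a) ⋆ scalarDensity u) x‖
      ≤ K * ‖a‖ * ‖b‖ * ∫ y, ‖scalarDensity u y‖ :=
        norm_convolution_lsmul_le (fun z => hK z a b) hd x
    _ = K * (∫ y, ‖scalarDensity u y‖) * ‖a‖ * ‖b‖ := by ring

/-- **`‖D²(k ⋆ d)(x)‖ ≤ ‖D²k‖_∞ ‖d‖_{L¹}`** for the vector potential. [folklore] -/
theorem norm_fderiv_fderiv_potential_vector_le {K : ℝ} (hK0 : 0 ≤ K)
    (hK : ∀ z a b, ‖fderiv ℝ (fun w => fderiv ℝ annularKernel w b) z a‖ ≤ K * ‖a‖ * ‖b‖)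
    (hd : Integrable (vectorDensity u)) (x : EuclideanSpace ℝ (Fin 3)) :
    ‖fderiv ℝ (fderiv ℝ (annularKernel ⋆[lsmul ℝ ℝ, volume] vectorDensity u)) x‖ ≤
      K * ∫ y, ‖vectorDensity u y‖ := by
  have hI : 0 ≤ ∫ y, ‖vectorDensity u y‖ := integral_nonneg fun _ => norm_nonneg _
  have hG : ContDiff ℝ 2 (annularKernel ⋆[lsmul ℝ ℝ, volume] vectorDensity u) :=
    contDiff_potential_vector hd.locallyIntegrable
  have hdG : DifferentiableAt ℝ (fderiv ℝ (annularKernel ⋆[lsmul ℝ ℝ, volume] vectorDensity u)) x :=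
    ((hG.fderiv_right (m := 1) le_rfl).differentiable one_ne_zero) x
  refine ContinuousLinearMap.opNorm_le_bound _ (by positivity) fun a => ?_
  refine ContinuousLinearMap.opNorm_le_bound _ (by positivity) fun b => ?_
  have hkb : ContDiff ℝ 1 fun z => fderiv ℝ annularKernel z b :=
    (contDiff_annularKernel.fderiv_right (m := 1) le_rfl).clm_apply contDiff_const
  have hkbc : HasCompactSupport fun z => fderiv ℝ annularKernel z b :=
    hasCompactSupport_annularKernel.fderiv_apply (𝕜 := ℝ) b
  rw [← fderiv_apply_const_apply hdG b a, fderiv_potential_vector_eq hd.locallyIntegrable b,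
    fderiv_convolution_apply_eq hkb hkbc hd.locallyIntegrable x a]
  calc ‖∫ y, (fderiv ℝ (fun w => fderiv ℝ annularKernel w b) (x - y) a) • vectorDensity u y‖
      ≤ K * ‖a‖ * ‖b‖ * ∫ y, ‖vectorDensity u y‖ :=
        norm_integral_comp_sub_smul_le
          (k := fun z => fderiv ℝ (fun w => fderiv ℝ annularKernel w b) z a)
          (fun z => hK z a b) hd x
    _ = K * (∫ y, ‖vectorDensity u y‖) * ‖a‖ * ‖b‖ := by ring

/-- **The gradient of the harmonic part is bounded by the `L¹(B₂)` norm of the velocity**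
(Kwon 2023, Remark 2.3, (2.4) with `m = 1`, and Lemma 2.5, (est.h) with `k = 1` at a fixed
time: `‖∇h‖_{L^∞(B₁)} ≲ ‖u‖_{L¹(B₂)}`; here even globally in `x`): there is an absolute `C`
with `‖Dh(x)‖ ≤ C ∫_{B₂} |u|` for every `u ∈ L¹(B₂)` and every `x`. [cite: Kwon2023RolePressure, Remark 2.3 (2.4) and Lemma 2.5 (est.h)] -/
theorem exists_norm_fderiv_harmonicPart_le :
    ∃ C : ℝ, 0 ≤ C ∧ ∀ (u : EuclideanSpace ℝ (Fin 3) → EuclideanSpace ℝ (Fin 3)),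
      IntegrableOn u (ball (0 : EuclideanSpace ℝ (Fin 3)) 2) →
      ∀ x, ‖fderiv ℝ (harmonicPart u) x‖ ≤
        C * ∫ y in ball (0 : EuclideanSpace ℝ (Fin 3)) 2, ‖u y‖ := by
  obtain ⟨K, hK0, hK⟩ := exists_bound_fderiv_fderiv_annularKernel
  obtain ⟨Cφ, hCφ0, hCφ⟩ := exists_bound_gradient_kwonCutoff
  refine ⟨(K + ‖curlCLM‖ * K) * Cφ, by positivity, fun u hu x => ?_⟩
  have hd₁ := integrable_scalarDensity hu
  have hd₂ := integrable_vectorDensity hu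
  set F := annularKernel ⋆ scalarDensity u with hFdef
  set G := annularKernel ⋆[lsmul ℝ ℝ, volume] vectorDensity u with hGdef
  have hF : ContDiff ℝ 2 F := contDiff_potential_scalar hd₁.locallyIntegrable
  have hG : ContDiff ℝ 2 G := contDiff_potential_vector hd₂.locallyIntegrable
  have hdF : DifferentiableAt ℝ (fderiv ℝ F) x :=
    ((hF.fderiv_right (m := 1) le_rfl).differentiable one_ne_zero) x
  have hdG : DifferentiableAt ℝ (fderiv ℝ G) x :=
    ((hG.fderiv_right (m := 1) le_rfl).differentiable one_ne_zero) x
  have hI : 0 ≤ ∫ y in ball (0 : EuclideanSpace ℝ (Fin 3)) 2, ‖u y‖ :=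
    integral_nonneg fun _ => norm_nonneg _
  -- the gradient piece: `D(∇F) = T ∘ D²F` with `T` the Riesz isometry
  set T : StrongDual ℝ (EuclideanSpace ℝ (Fin 3)) ≃L[ℝ] EuclideanSpace ℝ (Fin 3) :=
    (InnerProductSpace.toDual ℝ (EuclideanSpace ℝ (Fin 3))).symm.toContinuousLinearEquiv with hT
  have e1 : gradient F = T ∘ fderiv ℝ F := by funext y; rfl
  have h1 : ‖fderiv ℝ (gradient F) x‖ ≤ K * ∫ y, ‖scalarDensity u y‖ := by
    rw [e1, T.comp_fderiv]
    refine ContinuousLinearMap.opNorm_le_bound _ (by positivity) fun a => ?_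
    rw [ContinuousLinearMap.comp_apply]
    have : ‖(T : StrongDual ℝ (EuclideanSpace ℝ (Fin 3)) →L[ℝ] EuclideanSpace ℝ (Fin 3))
        (fderiv ℝ (fderiv ℝ F) x a)‖ = ‖fderiv ℝ (fderiv ℝ F) x a‖ :=
      (InnerProductSpace.toDual ℝ (EuclideanSpace ℝ (Fin 3))).symm.norm_map _
    rw [this]
    calc ‖fderiv ℝ (fderiv ℝ F) x a‖ ≤ ‖fderiv ℝ (fderiv ℝ F) x‖ * ‖a‖ := le_opNorm _ _
      _ ≤ (K * ∫ y, ‖scalarDensity u y‖) * ‖a‖ :=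
          mul_le_mul_of_nonneg_right (norm_fderiv_fderiv_potential_scalar_le hK0 hK hd₁ x)
            (norm_nonneg _)
  -- the curl piece: `D(curl G) = curlCLM ∘ D²G`
  have h2 : ‖fderiv ℝ (curl G) x‖ ≤ ‖curlCLM‖ * (K * ∫ y, ‖vectorDensity u y‖) := by
    rw [curl_eq_curlCLM_comp, (curlCLM.hasFDerivAt.comp x hdG.hasFDerivAt).fderiv]
    calc ‖curlCLM.comp (fderiv ℝ (fderiv ℝ G) x)‖ ≤ ‖curlCLM‖ * ‖fderiv ℝ (fderiv ℝ G) x‖ :=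
          opNorm_comp_le _ _
      _ ≤ ‖curlCLM‖ * (K * ∫ y, ‖vectorDensity u y‖) :=
          mul_le_mul_of_nonneg_left (norm_fderiv_fderiv_potential_vector_le hK0 hK hd₂ x)
            (norm_nonneg curlCLM)
  have h3 := integral_norm_scalarDensity_le hCφ hu
  have h4 := integral_norm_vectorDensity_le hCφ hu
  have hgrad : DifferentiableAt ℝ (gradient F) x := by
    rw [e1]; exact T.differentiableAt.comp x hdF
  have hcurl : DifferentiableAt ℝ (curl G) x :=
    (contDiff_curl (n := 1) (contDiff_potential_vector hd₂.locallyIntegrable)).differentiable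
      one_ne_zero x
  rw [show harmonicPart u = fun y => gradient F y - curl G y from rfl, fderiv_fun_sub hgrad hcurl]
  calc ‖fderiv ℝ (gradient F) x - fderiv ℝ (curl G) x‖
      ≤ ‖fderiv ℝ (gradient F) x‖ + ‖fderiv ℝ (curl G) x‖ := norm_sub_le _ _
    _ ≤ K * (Cφ * ∫ y in ball (0 : EuclideanSpace ℝ (Fin 3)) 2, ‖u y‖) +
          ‖curlCLM‖ * (K * (Cφ * ∫ y in ball (0 : EuclideanSpace ℝ (Fin 3)) 2, ‖u y‖)) := by
        gcongr
        · exact h1.trans (mul_le_mul_of_nonneg_left h3 hK0)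
        · exact h2.trans (mul_le_mul_of_nonneg_left (mul_le_mul_of_nonneg_left h4 hK0)
            (norm_nonneg curlCLM))
    _ = (K + ‖curlCLM‖ * K) * Cφ * ∫ y in ball (0 : EuclideanSpace ℝ (Fin 3)) 2, ‖u y‖ := by
        ring

end Kwon2023

end Literature.Analysis.FluidPDE

end
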